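import Summits.Parity.BatemanHorn.Theses.IsogenyRedei
import Summits.Parity.BatemanHorn.Theorems.IsogenyRedeiSliceFramePell
import Summits.Parity.BatemanHorn.Theorems.IsogenyRedeiSliceFrameParity
import Summits.Parity.BatemanHorn.Theorems.IsogenyRedeiSliceFrameCounting
import Summits.Parity.BatemanHorn.Theorems.IsogenyRedeiSliceFrameSieve
import Summits.Parity.BatemanHorn.Theorems.IsogenyRedeiSliceFrameCofactorBound
import Summits.Parity.BatemanHorn.Theorems.IsogenyRedeiSliceFrameSlice

/-!
# Route `IsogenyRedei` — support item `SliceFrame` (stmt-Parity-14953): the frame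

`SliceFrame : PencilSelmerDictionary → PencilSelmerParitySW → GaussianTailLargeCofactor →
PolyMobiusTailOffGaussian → PolyMobiusTail` (`sliceFrame_proof`).

Step (iii) and the assembly of steps (i)–(ii):
* case split on the Bateman–Horn system: every system other than `(1, X²+1)` is
  `PolyMobiusTailOffGaussian`'s business; for `k = 1`, `f = ![X²+1]` the frame summand is the
  `X²+1` slice after the `Fin 1` bookkeeping `tail_fin_one_X_sq_add_one`
  (`piFinset` over `Fin 1`, `((X²+1)(n)).toNat = n²+1`);
* the slice is `quadratic_slice` (`IsogenyRedeiSliceFrameSlice`) fed by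
  `GaussianTailLargeCofactor` and, for each cofactor `e`, by `cofactor_tail_isLittleO` ∘
  `cofactor_sum_bound` (`IsogenyRedeiSliceFrameCofactorBound`) ∘ `parityRate_of_dictionary`
  (`IsogenyRedeiSliceFrameParity`, the parity transfer through the dictionary, consumed at the
  single exponent `A = 20`); the inputs the helper files keep as hypotheses (so that each
  elaborates against library oleans alone) are discharged here: the root-class count
  `exists_card_sq_dvd_le`, the pointwise sieve `abs_cofactor_sum_le` with the periodic-twist lemma
  `abs_sum_mul_le_sum_abs_progressions`, the tail `sum_Ioc_one_div_mul_sqrt_le` and the large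
  range `sum_card_sq_dvd_large_le card_negPell_le` (negative Pell count).
-/

namespace Summit.Parity.BatemanHorn.Theorems.SliceFrame

open Finset Filter Asymptotics Polynomial
open Summit.Parity.BatemanHorn.Theses.IsogenyRedei

/-- Sums over `Fintype.piFinset` of a `Fin 1`-indexed family are sums over the single factor
(adapted from the tree's `PolyMobiusTail.Negative.sum_piFinset_fin_one`). [folklore] -/
theorem sum_piFinset_fin_one (t : Fin 1 → Finset ℕ) (G : ℕ → ℝ) :
    ∑ d ∈ Fintype.piFinset t, G (d 0) = ∑ j ∈ t 0, G j := by
  have h := Finset.prod_univ_sum t (fun _ j => G j)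
  simp only [Fin.prod_univ_one] at h
  exact h.symm

/-- **`Fin 1` bookkeeping (step (iii) of `SliceFrame`).** The summand of `PolyMobiusTail` at the
system `(1, ![X²+1])` is the `X²+1` slice in elementary form. [folklore] -/
theorem tail_fin_one_X_sq_add_one (η : ℝ) (x : ℕ) :
    (∑ n ∈ Finset.Icc 1 x, ∑ d ∈ Fintype.piFinset
        (fun i => (((![(X ^ 2 + 1 : ℤ[X])] i).eval (n : ℤ)).toNat).divisors),
      if (x : ℝ) ^ (1 - η) < ∏ i, (d i : ℝ) then
        ∏ i, ((ArithmeticFunction.moebius (d i) : ℝ) * Real.log (d i)) else 0)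
    = ∑ n ∈ Finset.Icc 1 x, ∑ d ∈ Nat.divisors (n ^ 2 + 1),
      if (x : ℝ) ^ (1 - η) < ((d : ℕ) : ℝ) then
        (ArithmeticFunction.moebius d : ℝ) * Real.log (d : ℝ) else 0 := by
  refine Finset.sum_congr rfl fun n _ => ?_
  have hev : ((X ^ 2 + 1 : ℤ[X]).eval (n : ℤ)).toNat = n ^ 2 + 1 := by
    simp only [eval_add, eval_pow, eval_X, eval_one]
    have : ((n : ℤ) ^ 2 + 1) = ((n ^ 2 + 1 : ℕ) : ℤ) := by push_cast; ring
    rw [this, Int.toNat_natCast]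
  simp only [Fin.prod_univ_one, Matrix.cons_val_fin_one, hev]
  exact sum_piFinset_fin_one (fun _ => (n ^ 2 + 1).divisors)
    (fun j => if (x : ℝ) ^ (1 - η) < (j : ℝ) then
      (ArithmeticFunction.moebius j : ℝ) * Real.log j else 0)

end Summit.Parity.BatemanHorn.Theorems.SliceFrame

namespace Summit.Parity.BatemanHorn.Theorems

open Filter Asymptotics Polynomial
open Summit.Parity.BatemanHorn.Theses.IsogenyRedei
open Summit.Parity.BatemanHorn.Theorems.SliceFrame

/-- **`SliceFrame`** (stmt-Parity-14953): the glue that puts the `X²+1` slice into the cone of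
`closes` — `PencilSelmerDictionary → PencilSelmerParitySW → GaussianTailLargeCofactor →
PolyMobiusTailOffGaussian → PolyMobiusTail`.  Proof: case split on the system; for
`(1, ![X²+1])` the parity transfer (exponent `A = 20`), the squarefree sieve with rates and the
negative Pell tail give `A_e(y) = O_e(y/(log y)²)` for every cofactor `e`, partial summation gives
the bounded-cofactor pieces `o(x)`, `GaussianTailLargeCofactor` gives the rest, and the `Fin 1`
bookkeeping identifies the slice with the frame summand. [folklore] -/
theorem sliceFrame_proof : SliceFrame := by
  intro hD hS hL hO k f hf
  by_cases hcase : k ≠ 1 ∨ ∃ i, f i ≠ Polynomial.X ^ 2 + 1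
  · exact hO k f hf hcase
  push Not at hcase
  obtain ⟨rfl, hfi⟩ := hcase
  have hfeq : f = ![(X ^ 2 + 1 : ℤ[X])] := by
    funext i
    fin_cases i
    simp [hfi]
  subst hfeq
  -- step (i-a): the parity transfer, consumed at `A = 20`
  have hP := parityRate_of_dictionary hD hS 20 (by norm_num)
  -- steps (i-b) + (ii): every bounded-cofactor piece is `o(x)`
  have hT : ∀ η : ℝ, ∀ e : ℕ, 1 ≤ e → (fun x : ℕ => ∑ n ∈ Finset.Icc 1 x,
      (if e ∣ n ^ 2 + 1 ∧ (x : ℝ) ^ (1 - η) < (((n ^ 2 + 1) / e : ℕ) : ℝ) then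
        (ArithmeticFunction.moebius ((n ^ 2 + 1) / e) : ℝ)
          * Real.log (((n ^ 2 + 1) / e : ℕ) : ℝ) else 0))
      =o[atTop] fun x : ℕ => (x : ℝ) :=
    fun η e he => cofactor_tail_isLittleO η
      (cofactor_sum_bound exists_card_sq_dvd_le
        (abs_cofactor_sum_le abs_sum_mul_le_sum_abs_progressions
          (fun R hR N => sum_Ioc_one_div_mul_sqrt_le hR N)
          (sum_card_sq_dvd_large_le card_negPell_le))
        hP he)
  -- the slice, and the `Fin 1` bookkeeping
  obtain ⟨η, hη0, hη1, hslice⟩ := quadratic_slice hL hT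
  refine ⟨η, hη0, hη1, ?_⟩
  exact hslice.congr' (Eventually.of_forall fun x => (tail_fin_one_X_sq_add_one η x).symm)
    EventuallyEq.rfl

end Summit.Parity.BatemanHorn.Theorems
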